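import Literature.NumberTheory.LFunctions.HeckeThetaMellin
import HarnessLib

/-!
# The Gamma integral of Hecke's weighted theta summand in Hecke's coordinates

Topic `Literature/NumberTheory/LFunctions`; namespace `Literature.NumberTheory.LFunctions.NumberField`
(continuing `HeckeThetaMellin.lean`; generalises the "Mellin–Gamma identity for a single `a ≠ 0`" of
`DedekindZetaMellinProofs.lean` from the Gaussian `e^{-π⟨ay,a⟩}` to the weighted summand
`|N(a^p)| N(y^{p/2}) e^{-π⟨ay,a⟩}` of `Θ̃^p`).

For `a ∈ K^*`, a set `p` of real places and real `σ > 0` we PROVE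
(`lintegral_Ioi_rpow_mul_lintegral_weightedThetaSummand_heckeCoord`)

  `∫_{t>0} t^{σ-1} ∫_{ℝ^{r-1}} |N(a^p)| N(y(c,t)^{p/2}) e^{-π⟨a y(c,t), a⟩} dc dt
     = 2^{-(r-1)} n (2^{-r₂} n R)⁻¹ · |N(a^p)| · ∏_w (π e_w |a|_w²)^{-κ_w} Γ(κ_w)`,
  `κ_w = e_w σ + p_w/2`  (`p_w = 1` for `w ∈ p`, else `0`),

i.e. Neukirch's substitution `y ↦ π|a|²y` in `Γ_X(𝐬/2)`, `𝐬 = 2σ𝟏 + p` (VII §8, proof of (8.3):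
`L_∞(χ,s) = L_X(s𝟏 + p)`, `Γ_X(𝐬/2) = N((π/|md|)^{𝐬/2}) N(|a|^𝐬) ∫ e^{-π⟨ay/|md|,a⟩} N(y^{𝐬/2}) dy/y`), in
Hecke's coordinates `y(c,t)` of `DedekindZetaMellin.lean` and with the Jacobian of Roblot's `expMapBasis`,
and the separation of the norm (`prod_weightedGammaFactor_eq_mul_norm_rpow`)

  `|N(a^p)| ∏_w (π e_w |a|_w²)^{-κ_w} Γ(κ_w) = A_p(σ) · |N_{K/ℚ}(a)|^{-2σ}`,
  `A_p(σ) = ∏_w (π e_w)^{-κ_w} Γ(κ_w)`  (= `π^{-n s/2 - |p|/2} 2^{-r₂ s} Γ(s/2)^{r₁-|p|} Γ((s+1)/2)^{|p|} Γ(s)^{r₂}`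
  at `s = 2σ`: the Euler factor at infinity of a Dirichlet character of type `p`, Neukirch VII (8.3)/(4.2)).

The proofs are those of `DedekindZetaMellinProofs.lean` ((A) scaling, (B) `t = e^{nτ}`, (C) splitting
`ℝ^{r-1} × ℝ ≅ ℝ^{places}`, (D) `y = expMapBasis x`, (E) Fubini with one-variable Gamma integrals), with the
exponents `e_w σ - 1` replaced by `κ_w - 1` and the extra factor `|N(a^p)| = ∏_{τ∈p} |a|_τ`.

## References

* J. Neukirch, *Algebraic Number Theory*, Grundlehren 322, Springer 1999, Ch. VII §4 (4.2), §5 before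
  (5.5), §8 proof of (8.3). [NeukirchANT1999]
-/

noncomputable section

open MeasureTheory Filter Set Submodule Complex NumberField NumberField.InfinitePlace
  NumberField.mixedEmbedding NumberField.Units
open scoped Real Topology ENNReal NumberField nonZeroDivisors

namespace Literature.NumberTheory.LFunctions

namespace NumberField

variable {K : Type*} [Field K] [NumberField K]

open scoped Classical

open NumberField.mixedEmbedding NumberField.mixedEmbedding.fundamentalCone
  NumberField.Units.dirichletUnitTheorem

/-! ## The exponents `κ_w = e_w σ + p_w/2` and the factor `|N(a^p)|` -/

variable (K) in
/-- The half-weight `p_w/2`: `1/2` at the real places of `p`, `0` elsewhere. [folklore] -/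
def halfWeight (p : Finset {w : InfinitePlace K // IsReal w}) (w : InfinitePlace K) : ℝ :=
  if h : IsReal w then (if (⟨w, h⟩ : {w : InfinitePlace K // IsReal w}) ∈ p then 1 / 2 else 0) else 0

omit [NumberField K] in
/-- `p_w/2 ≥ 0`. [folklore] -/
theorem halfWeight_nonneg (p : Finset {w : InfinitePlace K // IsReal w}) (w : InfinitePlace K) :
    0 ≤ halfWeight K p w := by
  unfold halfWeight; split_ifs <;> norm_num

omit [NumberField K] in
/-- At a real place of `p` the half-weight is `1/2`. [folklore] -/
theorem halfWeight_of_mem {p : Finset {w : InfinitePlace K // IsReal w}} {w : {w : InfinitePlace K // IsReal w}}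
    (hw : w ∈ p) : halfWeight K p w.1 = 1 / 2 := by
  unfold halfWeight
  rw [dif_pos w.2, if_pos (by simpa using hw)]

/-- **`∏_w y_w^{p_w/2} = N(y^{p/2}) = ∏_{τ∈p} y_τ^{1/2}`** (the product over all places of `y^{halfWeight}`
is the product over `p`). [folklore] -/
theorem prod_rpow_halfWeight (p : Finset {w : InfinitePlace K // IsReal w}) (y : InfinitePlace K → ℝ) :
    ∏ w : InfinitePlace K, y w ^ halfWeight K p w = ∏ w ∈ p, Real.sqrt (y w.1) := by
  -- the function vanishes to exponent `0` off the image of `p`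
  have h1 : ∏ w : InfinitePlace K, y w ^ halfWeight K p w =
      ∏ w ∈ p.map (Function.Embedding.subtype _), y w ^ halfWeight K p w := by
    symm
    refine Finset.prod_subset (Finset.subset_univ _) fun w _ hw ↦ ?_
    have : halfWeight K p w = 0 := by
      unfold halfWeight
      split_ifs with h h'
      · exact absurd (Finset.mem_map_of_mem (Function.Embedding.subtype _) h') (by simpa using hw)
      · rfl
      · rfl
    rw [this, Real.rpow_zero]
  rw [h1, Finset.prod_map]
  refine Finset.prod_congr rfl fun w hw ↦ ?_
  rw [Function.Embedding.coe_subtype, halfWeight_of_mem hw, Real.sqrt_eq_rpow]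

omit [NumberField K] in
/-- `|N(a^p)| = ∏_{τ∈p} |a|_τ` in terms of the real coordinates. [folklore] -/
theorem prod_abs_mixedEmbedding_eq (p : Finset {w : InfinitePlace K // IsReal w}) (a : K) :
    ∏ w ∈ p, |(mixedEmbedding K a).1 w| = ∏ w ∈ p, w.1 a :=
  Finset.prod_congr rfl fun w _ ↦ by
    rw [mixedEmbedding_apply_isReal, ← Real.norm_eq_abs, norm_embedding_of_isReal]

/-- The weighted summand as `|N(a^p)| N(y^{p/2}) e^{-π⟨ay,a⟩}` with `|N(a^p)| = ∏_{τ∈p} |a|_τ`. [folklore] -/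
theorem weightedThetaSummand_eq (p : Finset {w : InfinitePlace K // IsReal w}) (y : InfinitePlace K → ℝ)
    (a : K) : weightedThetaSummand K p y a =
      (∏ w ∈ p, w.1 a) * (∏ w ∈ p, Real.sqrt (y w.1)) * thetaSummand K y a := by
  rw [weightedThetaSummand, Finset.prod_mul_distrib, prod_abs_mixedEmbedding_eq]

/-! ## (D) The change of variables `y = expMapBasis x` for the weighted summand -/

/-- The Jacobian of `expMapBasis` against the weighted Gamma integrand (pointwise):
`|det D expMapBasis(x)| · ∏_w y_w^{κ_w - 1} e^{-b_w y_w} · |N(a^p)| = (2^{-r₂} n R) · e^{nσ x_{w₀}} · W_p(y, a)`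
at `y = expMapBasis x` (`b_w = π e_w |a|_w²`), from the case `p = ∅` (`abs_det_mul_prod_gammaIntegrand`)
multiplied by `N(y^{p/2}) |N(a^p)|`. [folklore] -/
theorem abs_det_mul_prod_weightedGammaIntegrand (p : Finset {w : InfinitePlace K // IsReal w})
    (x : realSpace K) (a : K) (σ : ℝ) :
    |(fderiv_expMapBasis K x).det| *
        ((∏ w, (expMapBasis x w) ^ ((mult w : ℝ) * σ + halfWeight K p w - 1) *
          Real.exp (-(Real.pi * mult w * (w a) ^ 2 * expMapBasis x w))) * ∏ w ∈ p, w.1 a) =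
      (2⁻¹ ^ nrComplexPlaces K * Module.finrank ℚ K * regulator K) *
        (Real.exp (Module.finrank ℚ K * σ * x w₀) *
          weightedThetaSummand K p (expMapBasis x) a) := by
  set y := expMapBasis x
  have hypos : ∀ w, 0 < y w := fun w ↦ expMapBasis_pos x w
  have h0 := abs_det_mul_prod_gammaIntegrand (K := K) x a σ
  -- split the exponents
  have hsplit : ∏ w, y w ^ ((mult w : ℝ) * σ + halfWeight K p w - 1) *
      Real.exp (-(Real.pi * mult w * (w a) ^ 2 * y w)) =
      (∏ w, y w ^ ((mult w : ℝ) * σ - 1) * Real.exp (-(Real.pi * mult w * (w a) ^ 2 * y w))) *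
        ∏ w ∈ p, Real.sqrt (y w.1) := by
    rw [← prod_rpow_halfWeight p y, ← Finset.prod_mul_distrib]
    refine Finset.prod_congr rfl fun w _ ↦ ?_
    rw [show (mult w : ℝ) * σ + halfWeight K p w - 1 = ((mult w : ℝ) * σ - 1) + halfWeight K p w by ring,
      Real.rpow_add (hypos w)]
    ring
  rw [hsplit, weightedThetaSummand_eq]
  calc |(fderiv_expMapBasis K x).det| *
        ((∏ w, y w ^ ((mult w : ℝ) * σ - 1) * Real.exp (-(Real.pi * mult w * (w a) ^ 2 * y w))) *
          (∏ w ∈ p, Real.sqrt (y w.1)) * ∏ w ∈ p, w.1 a)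
      = (|(fderiv_expMapBasis K x).det| *
          ∏ w, y w ^ ((mult w : ℝ) * σ - 1) * Real.exp (-(Real.pi * mult w * (w a) ^ 2 * y w))) *
          ((∏ w ∈ p, w.1 a) * ∏ w ∈ p, Real.sqrt (y w.1)) := by ring
    _ = _ := by rw [h0]; ring

/-- **Change of variables `y = expMapBasis x`** for the weighted Gamma integrand:
`∫_{(0,∞)^{places}} ∏_w y_w^{κ_w-1} e^{-π e_w|a|_w² y_w} |N(a^p)| dy
  = 2^{-r₂} n R ∫_{ℝ^{places}} e^{nσ x_{w₀}} W_p(expMapBasis(x), a) dx` (Mathlib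
`lintegral_image_eq_lintegral_abs_det_fderiv_mul`). [folklore] -/
theorem setLIntegral_pi_Ioi_prod_weightedGammaIntegrand_eq_lintegral_expMapBasis
    (p : Finset {w : InfinitePlace K // IsReal w}) (a : K) (σ : ℝ) :
    ∫⁻ y in Set.univ.pi (fun _ : InfinitePlace K ↦ Set.Ioi (0 : ℝ)),
        ENNReal.ofReal ((∏ w, (y w) ^ ((mult w : ℝ) * σ + halfWeight K p w - 1) *
          Real.exp (-(Real.pi * mult w * (w a) ^ 2 * y w))) * ∏ w ∈ p, w.1 a) =
      ENNReal.ofReal (2⁻¹ ^ nrComplexPlaces K * Module.finrank ℚ K * regulator K) *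
        ∫⁻ x : realSpace K, ENNReal.ofReal (Real.exp (Module.finrank ℚ K * σ * x w₀) *
          weightedThetaSummand K p (expMapBasis x) a) := by
  rw [← image_expMapBasis_univ, lintegral_image_eq_lintegral_abs_det_fderiv_mul volume
    MeasurableSet.univ (fun x _ ↦ (hasFDerivAt_expMapBasis K x).hasFDerivWithinAt)
    (injective_expMapBasis K).injOn, Measure.restrict_univ,
    ← lintegral_const_mul' _ _ ENNReal.ofReal_ne_top]
  refine lintegral_congr fun x ↦ ?_
  have hc : (0 : ℝ) ≤ 2⁻¹ ^ nrComplexPlaces K * Module.finrank ℚ K * regulator K :=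
    mul_nonneg (mul_nonneg (pow_nonneg (by norm_num) _) (Nat.cast_nonneg _)) (regulator_pos K).le
  rw [← ENNReal.ofReal_mul (abs_nonneg _), ← ENNReal.ofReal_mul hc, abs_det_mul_prod_weightedGammaIntegrand]

/-! ## (E) The Gamma integrals with exponents `κ_w` over the positive orthant -/

omit [NumberField K] in
/-- The exponents `κ_w = e_w σ + p_w/2` are positive for `σ > 0`. [folklore] -/
theorem kappa_pos (p : Finset {w : InfinitePlace K // IsReal w}) {σ : ℝ} (hσ : 0 < σ) (w : InfinitePlace K) :
    0 < (mult w : ℝ) * σ + halfWeight K p w := by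
  have : (0 : ℝ) < mult w := Nat.cast_pos.mpr mult_pos
  have := halfWeight_nonneg p w
  positivity

/-- **Product of Gamma integrals over the positive orthant** with exponents `κ_w`: for `a ≠ 0`, `σ > 0`,
`∫_{(0,∞)^{places}} ∏_w y_w^{κ_w - 1} e^{-π e_w |a|_w² y_w} dy = ∏_w (π e_w |a|_w²)^{-κ_w} Γ(κ_w)`
(Fubini, Mathlib `integral_fintype_prod_eq_prod`, `Real.integral_rpow_mul_exp_neg_mul_Ioi`).
[cite: NeukirchANT1999, Ch. VII (4.2) and §8 proof of (8.3)] -/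
theorem integral_pi_Ioi_prod_weightedGammaIntegrand (p : Finset {w : InfinitePlace K // IsReal w}) (a : K)
    (ha : a ≠ 0) {σ : ℝ} (hσ : 0 < σ) :
    ∫ y : InfinitePlace K → ℝ, ∏ w, (y w) ^ ((mult w : ℝ) * σ + halfWeight K p w - 1) *
        Real.exp (-(Real.pi * mult w * (w a) ^ 2 * y w))
        ∂(Measure.pi fun _ ↦ (volume : Measure ℝ).restrict (Set.Ioi 0)) =
      ∏ w : InfinitePlace K, (1 / (Real.pi * mult w * (w a) ^ 2)) ^ ((mult w : ℝ) * σ + halfWeight K p w) *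
        Real.Gamma ((mult w : ℝ) * σ + halfWeight K p w) := by
  rw [integral_fintype_prod_eq_prod (𝕜 := ℝ)
    (f := fun (w : InfinitePlace K) (u : ℝ) ↦ u ^ ((mult w : ℝ) * σ + halfWeight K p w - 1) *
      Real.exp (-(Real.pi * mult w * (w a) ^ 2 * u)))]
  refine Finset.prod_congr rfl fun w _ ↦ ?_
  have hb : 0 < Real.pi * mult w * (w a) ^ 2 := by
    have : 0 < w a := pos_iff.mpr ha
    have : (0 : ℝ) < mult w := Nat.cast_pos.mpr mult_pos
    positivity
  exact Real.integral_rpow_mul_exp_neg_mul_Ioi (kappa_pos p hσ w) hb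

/-- The same as an `ℝ≥0∞`-valued integral over the orthant, with the constant factor `|N(a^p)|`.
[folklore] -/
theorem setLIntegral_pi_Ioi_prod_weightedGammaIntegrand (p : Finset {w : InfinitePlace K // IsReal w})
    (a : K) (ha : a ≠ 0) {σ : ℝ} (hσ : 0 < σ) :
    ∫⁻ y in Set.pi Set.univ (fun _ : InfinitePlace K ↦ Set.Ioi (0 : ℝ)),
        ENNReal.ofReal ((∏ w, (y w) ^ ((mult w : ℝ) * σ + halfWeight K p w - 1) *
          Real.exp (-(Real.pi * mult w * (w a) ^ 2 * y w))) * ∏ w ∈ p, w.1 a) =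
      ENNReal.ofReal ((∏ w : InfinitePlace K, (1 / (Real.pi * mult w * (w a) ^ 2)) ^
          ((mult w : ℝ) * σ + halfWeight K p w) * Real.Gamma ((mult w : ℝ) * σ + halfWeight K p w)) *
        ∏ w ∈ p, w.1 a) := by
  have hmeas : volume.restrict (Set.pi Set.univ fun _ : InfinitePlace K ↦ Set.Ioi (0 : ℝ)) =
      Measure.pi fun _ ↦ (volume : Measure ℝ).restrict (Set.Ioi 0) :=
    Measure.restrict_pi_pi (fun _ : InfinitePlace K ↦ (volume : Measure ℝ)) fun _ ↦ Set.Ioi 0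
  have hP : 0 ≤ ∏ w ∈ p, w.1 a := Finset.prod_nonneg fun w _ ↦ apply_nonneg _ _
  rw [hmeas, ← integral_pi_Ioi_prod_weightedGammaIntegrand p a ha hσ, ← integral_mul_const,
    ofReal_integral_eq_lintegral_ofReal]
  · -- integrability
    refine Integrable.mul_const ?_ _
    refine Integrable.fintype_prod (f := fun (w : InfinitePlace K) (u : ℝ) ↦
      u ^ ((mult w : ℝ) * σ + halfWeight K p w - 1) * Real.exp (-(Real.pi * mult w * (w a) ^ 2 * u))) fun w ↦ ?_
    have hb : 0 < Real.pi * mult w * (w a) ^ 2 := by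
      have : 0 < w a := pos_iff.mpr ha
      have : (0 : ℝ) < mult w := Nat.cast_pos.mpr mult_pos
      positivity
    exact integrableOn_gammaIntegrand (kappa_pos p hσ w) hb
  · -- nonnegativity a.e.
    have hw : ∀ w : InfinitePlace K, ∀ᵐ u ∂((volume : Measure ℝ).restrict (Set.Ioi 0)), 0 < u :=
      fun w ↦ (ae_restrict_iff' measurableSet_Ioi).mpr (Filter.Eventually.of_forall fun u hu ↦ hu)
    have hall : ∀ᵐ y ∂(Measure.pi fun _ : InfinitePlace K ↦ (volume : Measure ℝ).restrict (Set.Ioi 0)),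
        ∀ w : InfinitePlace K, 0 < y w :=
      Filter.eventually_all.mpr fun w ↦
        (Measure.tendsto_eval_ae_ae (μ := fun _ : InfinitePlace K ↦
          (volume : Measure ℝ).restrict (Set.Ioi 0)) (i := w)).eventually (hw w)
    refine hall.mono fun y hy ↦ mul_nonneg ?_ hP
    exact Finset.prod_nonneg fun w _ ↦ mul_nonneg (Real.rpow_nonneg (hy w).le _) (Real.exp_nonneg _)

/-! ## The Mellin–Gamma identity for the weighted summand in Hecke's coordinates -/

/-- Measurability of `x ↦ W_p(expMapBasis x, a)`. [folklore] -/
theorem measurable_weightedThetaSummand_expMapBasis (p : Finset {w : InfinitePlace K // IsReal w}) (a : K) :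
    Measurable fun x : realSpace K ↦ weightedThetaSummand K p (expMapBasis x) a := by
  have hc : Continuous fun y : InfinitePlace K → ℝ ↦ weightedThetaSummand K p y a := by
    unfold weightedThetaSummand
    exact (continuous_finsetProd _ fun w _ ↦ continuous_const.mul
      (Real.continuous_sqrt.comp (continuous_apply _))).mul (continuous_thetaSummand a)
  exact hc.measurable.comp (continuous_expMapBasis K).measurable

/-- **The Gamma integral of Hecke's coordinates for the weighted summand** (Neukirch VII §8, proof of
(8.3): the substitution `y ↦ π|a|²y` in `Γ_X(𝐬/2)`, `𝐬 = 2σ𝟏 + p`, combined with the passage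
`R_+^* = S × ℝ_+^*` in Hecke's coordinates): for `a ≠ 0` and `σ > 0`,
`∫_{t>0} t^{σ-1} ∫_{ℝ^{r-1}} W_p(y(c,t), a) dc dt
   = 2^{-(r-1)} · n · (2^{-r₂} n R)⁻¹ · |N(a^p)| · ∏_w (π e_w |a|_w²)^{-κ_w} Γ(κ_w)` (`ℝ≥0∞`-valued).
[cite: NeukirchANT1999, Ch. VII §8 proof of (8.3)] -/
theorem lintegral_Ioi_rpow_mul_lintegral_weightedThetaSummand_heckeCoord
    (p : Finset {w : InfinitePlace K // IsReal w}) (a : K) (ha : a ≠ 0) {σ : ℝ} (hσ : 0 < σ) :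
    ∫⁻ t in Set.Ioi 0, ENNReal.ofReal (t ^ (σ - 1)) *
        ∫⁻ c : Fin (rank K) → ℝ, ENNReal.ofReal (weightedThetaSummand K p (heckeCoord K c t) a) =
      ENNReal.ofReal ((2 ^ rank K)⁻¹ * Module.finrank ℚ K *
        (2⁻¹ ^ nrComplexPlaces K * Module.finrank ℚ K * regulator K)⁻¹ *
        ((∏ w : InfinitePlace K, (1 / (Real.pi * mult w * (w a) ^ 2)) ^ ((mult w : ℝ) * σ + halfWeight K p w) *
          Real.Gamma ((mult w : ℝ) * σ + halfWeight K p w)) * ∏ w ∈ p, w.1 a)) := by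
  obtain ⟨e, hep, he⟩ := exists_measurableEquiv_realSpace_split (K := K)
  set n : ℕ := Module.finrank ℚ K with hn
  have hn0 : (0 : ℝ) < n := Nat.cast_pos.mpr Module.finrank_pos
  set cD : ℝ := 2⁻¹ ^ nrComplexPlaces K * n * regulator K with hcD
  have hcD0 : 0 < cD := by
    have := regulator_pos K
    positivity
  -- the integrand in `x ∈ ℝ^{places}`
  set H : realSpace K → ℝ≥0∞ := fun x ↦
    ENNReal.ofReal (Real.exp (n * σ * x w₀) * weightedThetaSummand K p (expMapBasis x) a) with hH
  have hHm : Measurable H :=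
    ((((measurable_pi_apply w₀).const_mul _).exp).mul (measurable_weightedThetaSummand_expMapBasis p a)).ennreal_ofReal
  -- Step 1–2: Hecke's coordinates through `e`, and the scaling `c = c'/2`
  have h12 : ∀ t : ℝ, ∫⁻ c : Fin (rank K) → ℝ, ENNReal.ofReal (weightedThetaSummand K p (heckeCoord K c t) a) =
      ENNReal.ofReal ((2 ^ rank K)⁻¹) *
        ∫⁻ c : Fin (rank K) → ℝ, ENNReal.ofReal (weightedThetaSummand K p (expMapBasis (e (c, Real.log t / n))) a) := by
    intro t
    have := lintegral_comp_two_smul (ι := Fin (rank K))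
      (fun c ↦ ENNReal.ofReal (weightedThetaSummand K p (expMapBasis (e (c, Real.log t / n))) a))
    simp only [Fintype.card_fin] at this
    rw [← this]
    refine lintegral_congr fun c ↦ ?_
    rw [← expMapBasis_heckeParam, heckeParam_eq_split e he]
  simp_rw [h12]
  -- Step 3–4: pull the constant, substitute `t = e^{nτ}`
  have h34 : ∫⁻ t in Set.Ioi 0, ENNReal.ofReal (t ^ (σ - 1)) * (ENNReal.ofReal ((2 ^ rank K)⁻¹) *
      ∫⁻ c : Fin (rank K) → ℝ, ENNReal.ofReal (weightedThetaSummand K p (expMapBasis (e (c, Real.log t / n))) a)) =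
      ENNReal.ofReal ((2 ^ rank K)⁻¹) * ∫⁻ τ, ENNReal.ofReal (n * Real.exp (n * σ * τ)) *
        ∫⁻ c : Fin (rank K) → ℝ, ENNReal.ofReal (weightedThetaSummand K p (expMapBasis (e (c, τ))) a) := by
    rw [← lintegral_Ioi_rpow_mul_comp_log_div hn0 σ, ← lintegral_const_mul' _ _ ENNReal.ofReal_ne_top]
    refine lintegral_congr fun t ↦ ?_
    ring
  rw [h34]
  -- Step 5–6: Tonelli on `ℝ^{r-1} × ℝ` and transport along `e`
  have hw0 : ∀ (c : Fin (rank K) → ℝ) (τ : ℝ), (e (c, τ) : realSpace K) w₀ = τ := fun c τ ↦ by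
    rw [he]; simp
  set f : (Fin (rank K) → ℝ) × ℝ → ℝ≥0∞ := fun z ↦ ENNReal.ofReal n * H (e z) with hf
  have hfm : Measurable f := (hHm.comp e.measurable).const_mul _
  have hpt : ∀ (c : Fin (rank K) → ℝ) (τ : ℝ), ENNReal.ofReal (n * Real.exp (n * σ * τ)) *
      ENNReal.ofReal (weightedThetaSummand K p (expMapBasis (e (c, τ))) a) = f (c, τ) := by
    intro c τ
    simp only [hf, hH, hw0]
    rw [ENNReal.ofReal_mul hn0.le, ENNReal.ofReal_mul (Real.exp_pos _).le, mul_assoc]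
  have h56 : ∫⁻ τ, ENNReal.ofReal (n * Real.exp (n * σ * τ)) *
      ∫⁻ c : Fin (rank K) → ℝ, ENNReal.ofReal (weightedThetaSummand K p (expMapBasis (e (c, τ))) a) =
      ENNReal.ofReal n * ∫⁻ x : realSpace K, H x := by
    calc ∫⁻ τ, ENNReal.ofReal (n * Real.exp (n * σ * τ)) *
          ∫⁻ c : Fin (rank K) → ℝ, ENNReal.ofReal (weightedThetaSummand K p (expMapBasis (e (c, τ))) a)
        = ∫⁻ τ, ∫⁻ c : Fin (rank K) → ℝ, f (c, τ) := by
          refine lintegral_congr fun τ ↦ ?_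
          rw [← lintegral_const_mul' _ _ ENNReal.ofReal_ne_top]
          exact lintegral_congr fun c ↦ hpt c τ
      _ = ∫⁻ z, f z ∂((volume : Measure (Fin (rank K) → ℝ)).prod (volume : Measure ℝ)) :=
          (lintegral_prod_symm f hfm.aemeasurable).symm
      _ = ∫⁻ z, f z := by rw [Measure.volume_eq_prod]
      _ = ENNReal.ofReal n * ∫⁻ z, H (e z) := lintegral_const_mul _ (hHm.comp e.measurable)
      _ = ENNReal.ofReal n * ∫⁻ x : realSpace K, H x := by rw [hep.lintegral_comp hHm]
  rw [h56]
  -- Step 7–8: change of variables to `y` and the Gamma integrals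
  have hD := setLIntegral_pi_Ioi_prod_weightedGammaIntegrand_eq_lintegral_expMapBasis (K := K) p a σ
  have hE := setLIntegral_pi_Ioi_prod_weightedGammaIntegrand (K := K) p a ha hσ
  rw [← hn] at hD
  rw [hE] at hD
  set Γp : ℝ := (∏ w : InfinitePlace K, (1 / (Real.pi * mult w * (w a) ^ 2)) ^ ((mult w : ℝ) * σ + halfWeight K p w) *
      Real.Gamma ((mult w : ℝ) * σ + halfWeight K p w)) * ∏ w ∈ p, w.1 a with hΓp
  have hHint : ∫⁻ x : realSpace K, H x = (ENNReal.ofReal cD)⁻¹ * ENNReal.ofReal Γp := by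
    rw [hD, ← mul_assoc, ENNReal.inv_mul_cancel (ENNReal.ofReal_pos.mpr hcD0).ne' ENNReal.ofReal_ne_top,
      one_mul]
  have hΓ : 0 ≤ Γp := by
    refine mul_nonneg (Finset.prod_nonneg fun w _ ↦ mul_nonneg (Real.rpow_nonneg ?_ _)
      (Real.Gamma_nonneg_of_nonneg (kappa_pos p hσ w).le)) (Finset.prod_nonneg fun w _ ↦ apply_nonneg _ _)
    have : (0 : ℝ) < mult w := Nat.cast_pos.mpr mult_pos
    positivity
  rw [hHint, ← ENNReal.ofReal_inv_of_pos hcD0, ← ENNReal.ofReal_mul (inv_nonneg.mpr hcD0.le),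
    ← ENNReal.ofReal_mul hn0.le, ← ENNReal.ofReal_mul (by positivity)]
  congr 1
  ring

/-! ## Separating the norm: `|N(a^p)| ∏_w (π e_w |a|_w²)^{-κ_w} Γ(κ_w) = A_p(σ) |N(a)|^{-2σ}` -/

/-- **Separating the norm** for the weighted Gamma factor:
`|N(a^p)| · ∏_w (π e_w |a|_w²)^{-κ_w} Γ(κ_w) = [∏_w (π e_w)^{-κ_w} Γ(κ_w)] · |N_{K/ℚ}(a)|^{-2σ}`
(`∏_w |a|_w^{-2κ_w} · ∏_{τ∈p} |a|_τ = ∏_w |a|_w^{-2e_wσ} = |N(a)|^{-2σ}`, Mathlib `prod_eq_abs_norm`; this is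
`N(a^p)/N(|a|^𝐬) = N(a^p |a|^{-p}) |N(a)|^{-s}` in the proof of Neukirch VII (8.3)).
[cite: NeukirchANT1999, Ch. VII §8 proof of (8.3)] -/
theorem prod_weightedGammaFactor_eq_mul_norm_rpow (p : Finset {w : InfinitePlace K // IsReal w}) (a : K)
    (ha : a ≠ 0) (σ : ℝ) :
    (∏ w : InfinitePlace K, (1 / (Real.pi * mult w * (w a) ^ 2)) ^ ((mult w : ℝ) * σ + halfWeight K p w) *
        Real.Gamma ((mult w : ℝ) * σ + halfWeight K p w)) * ∏ w ∈ p, w.1 a =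
      (∏ w : InfinitePlace K, (1 / (Real.pi * mult w)) ^ ((mult w : ℝ) * σ + halfWeight K p w) *
          Real.Gamma ((mult w : ℝ) * σ + halfWeight K p w)) *
        (|(Algebra.norm ℚ a : ℚ)| : ℝ) ^ (-2 * σ) := by
  have hwpos : ∀ w : InfinitePlace K, 0 < w a := fun w ↦ pos_iff.mpr ha
  -- split each factor: `(1/(π e |a|²))^κ = (1/(π e))^κ · |a|^{-2κ}`
  have hfac : ∀ w : InfinitePlace K,
      (1 / (Real.pi * mult w * (w a) ^ 2)) ^ ((mult w : ℝ) * σ + halfWeight K p w) =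
      (1 / (Real.pi * mult w)) ^ ((mult w : ℝ) * σ + halfWeight K p w) *
        ((w a) ^ (-(2 * ((mult w : ℝ) * σ))) * (w a) ^ (-(2 * halfWeight K p w))) := by
    intro w
    have hm : (0 : ℝ) < mult w := Nat.cast_pos.mpr mult_pos
    have h1 : (0 : ℝ) ≤ 1 / (Real.pi * mult w) := by positivity
    rw [show (1 : ℝ) / (Real.pi * mult w * (w a) ^ 2) = (1 / (Real.pi * mult w)) * ((w a) ^ 2)⁻¹ by
      field_simp, Real.mul_rpow h1 (inv_nonneg.mpr (sq_nonneg _))]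
    congr 1
    rw [Real.inv_rpow (sq_nonneg _), ← Real.rpow_neg (sq_nonneg _), ← Real.rpow_natCast,
      ← Real.rpow_mul (hwpos w).le, ← Real.rpow_add (hwpos w)]
    congr 1
    push_cast
    ring
  -- `∏_w |a|_w^{-2 halfWeight} · ∏_{τ∈p} |a|_τ = 1`
  have hhalf : (∏ w : InfinitePlace K, (w a) ^ (-(2 * halfWeight K p w))) * ∏ w ∈ p, w.1 a = 1 := by
    have h1 : ∏ w : InfinitePlace K, (w a) ^ (-(2 * halfWeight K p w)) =
        ∏ w ∈ p.map (Function.Embedding.subtype _), (w a) ^ (-(2 * halfWeight K p w)) := by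
      symm
      refine Finset.prod_subset (Finset.subset_univ _) fun w _ hw ↦ ?_
      have : halfWeight K p w = 0 := by
        unfold halfWeight
        split_ifs with h h'
        · exact absurd (Finset.mem_map_of_mem (Function.Embedding.subtype _) h') (by simpa using hw)
        · rfl
        · rfl
      rw [this, mul_zero, neg_zero, Real.rpow_zero]
    rw [h1, Finset.prod_map, ← Finset.prod_mul_distrib]
    refine Finset.prod_eq_one fun w hw ↦ ?_
    rw [Function.Embedding.coe_subtype, halfWeight_of_mem hw,
      show -(2 * (1 / 2 : ℝ)) = -1 by norm_num, Real.rpow_neg_one, inv_mul_cancel₀ (hwpos w.1).ne']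
  -- `∏_w |a|_w^{-2 e_w σ} = |N(a)|^{-2σ}`
  have hnorm : ∏ w : InfinitePlace K, (w a) ^ (-(2 * ((mult w : ℝ) * σ))) =
      (|(Algebra.norm ℚ a : ℚ)| : ℝ) ^ (-2 * σ) := by
    have : ∀ w : InfinitePlace K, (w a) ^ (-(2 * ((mult w : ℝ) * σ))) = ((w a) ^ mult w) ^ (-2 * σ) := by
      intro w
      rw [← Real.rpow_natCast, ← Real.rpow_mul (hwpos w).le]
      congr 1; ring
    simp_rw [this]
    rw [Real.finsetProd_rpow _ _ (fun w _ ↦ pow_nonneg (hwpos w).le _), prod_eq_abs_norm]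
    push_cast
    rfl
  have hsplit : ∏ w : InfinitePlace K, (1 / (Real.pi * mult w * (w a) ^ 2)) ^ ((mult w : ℝ) * σ + halfWeight K p w) *
        Real.Gamma ((mult w : ℝ) * σ + halfWeight K p w) =
      (∏ w : InfinitePlace K, (1 / (Real.pi * mult w)) ^ ((mult w : ℝ) * σ + halfWeight K p w) *
          Real.Gamma ((mult w : ℝ) * σ + halfWeight K p w)) *
        ∏ w : InfinitePlace K, ((w a) ^ (-(2 * ((mult w : ℝ) * σ))) * (w a) ^ (-(2 * halfWeight K p w))) := by
    rw [← Finset.prod_mul_distrib]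
    refine Finset.prod_congr rfl fun w _ ↦ ?_
    rw [hfac w]
    ring
  rw [hsplit, mul_assoc]
  congr 1
  rw [Finset.prod_mul_distrib, mul_assoc, hhalf, mul_one, hnorm]

end NumberField

end Literature.NumberTheory.LFunctions
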